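import Literature.MathematicalPhysics.QuantumFieldTheory.Balaban1983to89.LatticeWordStokes
import Summits.QuantumFields.BalabanUV.T4Continuum.Support.B13AvgCorrStokes
import HarnessLib

/-!
# `AlphaInputsT3ACv3BoxStokesDefect` — BOX-LOCAL LATTICE STOKES, PART 1: prefix positions of walks in PRODUCT SETS of sites, and the
# commutator defect of two letters read on ONE plaquette of the box — lane `pub-balaban3d`, seat alpha-2 (g4)

WHY (HOME `pub-balaban3d` STATUS, alpha-2 g4 STARTED line; memo `D6L-STATUS-alpha2-g3.md` §7).  The witness for the displayed row
(D6R-CHARGED) of 2′ is a GLUED configuration (a lift of the datum under `Ω_k(h)`, the lane's profile outside); every row must then be read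
through EXACT locality.  The tree's Stokes letters are global (`LatticeWordStokes.dist1_holAt_le`: `PlaqSmall δ U` on the whole torus) or
ball-local (`HistoryTailStokesLocal`; `BlockAveragingPlaquetteBoundLocal.dist1_loopHol_le_local`: blocks `c₋ − e, c₋, c₊`), whereas the (0.4)
loop `Γ ∪ [x,x′] ∪ (−Γ′) ∪ (−c)` lives in the two blocks `B(c₋) ∪ B(c₊)` and is null-homotopic THERE.  The sibling `…v3BoxStokes` proves the
box-local bound with the SAME constant; THIS FILE is its bookkeeping: §1 prefix positions of `l :: w` ∕ `A ++ w`, product sets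
`S = Π_κ I_κ` (written `{z | ∀ κ, z κ ∈ I κ}`, ARBITRARY coordinate sets `I_κ ⊂ ℤ/n` — no interval structure, so no wrap-around case analysis) and
COORDINATE MIXING (`y, y + m₁ + m₂ ∈ S ⇒ y + m₁, y + m₂ ∈ S` for letters of different directions); §2 the commutator defect
`𝒰_y(m₁m₂)·𝒰_y(m₂m₁)⁻¹` is a conjugate of ONE plaquette variable whose lower-left and upper-right corners lie in `S` (the four sign cases of
`LatticeWordStokes.dist1_swapDefect_lt_of_lt`, read pointwise), hence an adjacent transposition costs one plaquette OF THE BOX.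
HONEST FRAMING.  Lattice combinatorics over the tree's own words; nothing of [Balaban1985Averaging] is asserted beyond what is proved; count-neutral
helper toward R3 2′ (`stub_laneRecordsV3`, items 19935∕19936); registry untouched; nothing about d = 4, the continuum, or a mass gap.

References: T. Bałaban, Commun. Math. Phys. 98 (1985) 17–51 [Balaban1985Averaging] ((9) p.19, (19)–(20) p.21, locality p.25); CMP 109 (1987)
249–301 [Balaban1987RG1] ((0.3)–(0.4) pp.252–253).
-/

set_option autoImplicit false

namespace Summit.QuantumFields.YangMills.Theorems.BoxStokes

open Literature.MathematicalPhysics.QuantumFieldTheory.Balaban1983to89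
open T4Continuum T4ReflectionCone LatticeWordStokes BlockAveraging
open Summit.QuantumFields.BalabanUV.T4Continuum.B13AvgCorrStokes (walkEnd_pair_comm)

variable {P : Params} {j : ℕ}

/-! ## §1 Prefix positions of walks; product sets of sites -/

section Prefix

/-- The empty walk stays at its base. [folklore] -/
@[simp] theorem walkEnd_nil' (x : Site P j) : walkEnd x ([] : List (Letter P.d)) = x := rfl

/-- A backtrack `m m̄` returns to its base. [folklore] -/
theorem walkEnd_pair_flip (y : Site P j) (m : Letter P.d) : walkEnd y [m, m.flip] = y := by
  funext ν
  rw [walkEnd_apply, netDisp_cons, netDisp_cons]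
  obtain ⟨a, s⟩ := m
  cases s <;> by_cases h : a = ν <;> simp [netDisp, Letter.flip, h]

/-- The walk of `l :: w` from `x` continues from `walkEnd x [l]`. [folklore] -/
theorem walkEnd_cons_eq (x : Site P j) (l : Letter P.d) (w : List (Letter P.d)) : walkEnd x (l :: w) = walkEnd (walkEnd x [l]) w := by
  rw [show l :: w = [l] ++ w from rfl, walkEnd_append]

/-- **PREFIX POSITIONS OF `l :: w`**: the base, then the prefix positions of `w` from `walkEnd x [l]`. [folklore] -/
theorem forall_take_cons_iff (S : Set (Site P j)) (x : Site P j) (l : Letter P.d) (w : List (Letter P.d)) :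
    (∀ i, walkEnd x ((l :: w).take i) ∈ S) ↔ x ∈ S ∧ ∀ i, walkEnd (walkEnd x [l]) (w.take i) ∈ S := by
  constructor
  · intro h
    refine ⟨by simpa using h 0, fun i => ?_⟩
    have := h (i + 1)
    rwa [List.take_succ_cons, walkEnd_cons_eq] at this
  · rintro ⟨hx, h⟩ i
    cases i with
    | zero => simpa using hx
    | succ i => rw [List.take_succ_cons, walkEnd_cons_eq]; exact h i

/-- **PREFIX POSITIONS OF `A ++ w`**: those of `A`, then those of `w` from `walkEnd x A`. [folklore] -/
theorem forall_take_append_iff (S : Set (Site P j)) (x : Site P j) :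
    ∀ (A w : List (Letter P.d)), (∀ i, walkEnd x ((A ++ w).take i) ∈ S) ↔
      (∀ i, walkEnd x (A.take i) ∈ S) ∧ ∀ i, walkEnd (walkEnd x A) (w.take i) ∈ S
  | [], w => by
    constructor
    · intro h; exact ⟨fun i => by simpa using h 0, by simpa using h⟩
    · rintro ⟨-, h⟩; simpa using h
  | l :: A, w => by
    rw [List.cons_append, forall_take_cons_iff, forall_take_append_iff S (walkEnd x [l]) A w, forall_take_cons_iff,
      ← walkEnd_cons_eq]
    exact ⟨fun ⟨h1, h2, h3⟩ => ⟨⟨h1, h2⟩, h3⟩, fun ⟨⟨h1, h2⟩, h3⟩ => ⟨h1, h2, h3⟩⟩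

/-- The last prefix position of a word all of whose prefix positions lie in `S`. [folklore] -/
theorem walkEnd_mem_of_forall_take {S : Set (Site P j)} {x : Site P j} {w : List (Letter P.d)}
    (h : ∀ i, walkEnd x (w.take i) ∈ S) : walkEnd x w ∈ S := by
  simpa using h w.length

variable {I : Fin P.d → Set (ZMod (P.sitesPerDir j))}

/-- **COORDINATE MIXING IN A PRODUCT SET**: for two letters of DIFFERENT directions, if `y` and `y + m₁ + m₂` lie in `Π I_κ` then so do
`y + m₁` and `y + m₂` (each coordinate of `y + m₁` is a coordinate of `y` or of `y + m₁ + m₂`). [folklore] -/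
theorem walkEnd_single_mem_pi {y : Site P j} {m₁ m₂ : Letter P.d} (hne : m₁.1 ≠ m₂.1) (hy : y ∈ {z : Site P j | ∀ κ, z κ ∈ I κ})
    (hy2 : walkEnd y [m₁, m₂] ∈ {z : Site P j | ∀ κ, z κ ∈ I κ}) : walkEnd y [m₁] ∈ {z : Site P j | ∀ κ, z κ ∈ I κ} ∧ walkEnd y [m₂] ∈ {z : Site P j | ∀ κ, z κ ∈ I κ} := by
  simp only [Set.mem_setOf_eq] at hy hy2 ⊢
  obtain ⟨a, s⟩ := m₁
  obtain ⟨b, t⟩ := m₂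
  simp only [ne_eq] at hne
  constructor
  · intro κ
    by_cases hκ : κ = a
    · have h := hy2 κ
      rw [walkEnd_apply, netDisp_cons, netDisp_cons] at h
      rw [walkEnd_apply, netDisp_cons]
      subst hκ
      simpa [netDisp, Ne.symm hne] using h
    · have h := hy κ
      rw [walkEnd_apply, netDisp_cons]
      simpa [netDisp, Ne.symm hκ] using h
  · intro κ
    by_cases hκ : κ = b
    · have h := hy2 κ
      rw [walkEnd_apply, netDisp_cons, netDisp_cons] at h
      rw [walkEnd_apply, netDisp_cons]
      subst hκ
      simpa [netDisp, hne] using h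
    · have h := hy κ
      rw [walkEnd_apply, netDisp_cons]
      simpa [netDisp, Ne.symm hκ] using h

end Prefix

/-! ## §2 The commutator defect of two letters, read on ONE plaquette of the box -/

section Defect

variable {G : Type*} [GaugeGroup G] (U : GaugeField P j G)

/-- `(x + e_a) − e_a = x`. [folklore] -/
private theorem unshift_shift (x : Site P j) (a : Fin P.d) : (x.shift a).unshift a = x := by
  funext i
  by_cases h : i = a
  · subst h; simp [Site.shift, Site.unshift]
  · simp [Site.shift, Site.unshift, h]

/-- `(x − e_a) + e_a = x`. [folklore] -/
private theorem shift_unshift (x : Site P j) (a : Fin P.d) : (x.unshift a).shift a = x := by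
  funext i
  by_cases h : i = a
  · subst h; simp [Site.shift, Site.unshift]
  · simp [Site.shift, Site.unshift, h]

/-- `(x + e_a) + e_b = (x + e_b) + e_a`. [folklore] -/
private theorem shift_shift_comm (x : Site P j) (a b : Fin P.d) : (x.shift a).shift b = (x.shift b).shift a := by
  funext i
  by_cases ha : i = a <;> by_cases hb : i = b
  · subst ha; subst hb; rfl
  · subst ha; simp [Site.shift, hb]
  · subst hb; simp [Site.shift, ha]
  · simp [Site.shift, ha, hb]

/-- `(x − e_a) − e_b = (x − e_b) − e_a`. [folklore] -/
private theorem unshift_unshift_comm (x : Site P j) (a b : Fin P.d) : (x.unshift a).unshift b = (x.unshift b).unshift a := by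
  funext i
  by_cases ha : i = a <;> by_cases hb : i = b
  · subst ha; subst hb; rfl
  · subst ha; simp [Site.unshift, hb]
  · subst hb; simp [Site.unshift, ha]
  · simp [Site.unshift, ha, hb]

/-- `(x + e_a) − e_b = (x − e_b) + e_a`. [folklore] -/
private theorem shift_unshift_comm (x : Site P j) (a b : Fin P.d) : (x.shift a).unshift b = (x.unshift b).shift a := by
  by_cases hab : a = b
  · subst hab; rw [unshift_shift, shift_unshift]
  funext i
  by_cases ha : i = a <;> by_cases hb : i = b
  · exact absurd (ha.symm.trans hb) hab
  · subst ha; simp [Site.shift, Site.unshift, hb]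
  · subst hb; simp [Site.shift, Site.unshift, ha]
  · simp [Site.shift, Site.unshift, ha, hb]

variable {I : Fin P.d → Set (ZMod (P.sitesPerDir j))}

/-- **THE COMMUTATOR DEFECT, ORDERED NON-PARALLEL CASE, BOX-LOCAL** (`a < b`): if `y` and `y ± e_a ± e_b` lie in the product set `Π I_κ`
then `𝒰_y((a,s)(b,t))·𝒰_y((b,t)(a,s))⁻¹` is a conjugate of `U(∂p)^{±1}` for the plaquette `p = ⟨z, a, b⟩`, `z ∈ {y, y−a, y−b, y−a−b}`,
whose lower-left and upper-right corners lie in `Π I_κ`; hence within `δ` of `1`. [cite: Balaban1985Averaging, (9) p.19 and (19)-(20) p.21] -/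
theorem dist1_swapDefect_le_pi_of_lt {δ : ℝ}
    (hU : ∀ q : Plaq P j, q.src ∈ {z : Site P j | ∀ κ, z κ ∈ I κ} → (q.src.shift q.μ).shift q.ν ∈ {z : Site P j | ∀ κ, z κ ∈ I κ} → dist1 (GaugeField.plaqHol U q) ≤ δ)
    (y : Site P j) {a b : Fin P.d} (hab : a < b) (s t : Bool) (hy : y ∈ {z : Site P j | ∀ κ, z κ ∈ I κ})
    (hy2 : walkEnd y [(a, s), (b, t)] ∈ {z : Site P j | ∀ κ, z κ ∈ I κ}) :
    dist1 (holAt U (walk y [(a, s), (b, t)]) * (holAt U (walk y [(b, t), (a, s)]))⁻¹) ≤ δ := by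
  have hne : ((a, s) : Letter P.d).1 ≠ ((b, t) : Letter P.d).1 := ne_of_lt hab
  obtain ⟨hya, hyb⟩ := walkEnd_single_mem_pi hne hy hy2
  cases s <;> cases t
  · -- (−a, −b): plaquette at z = y − a − b, upper-right corner y
    have hsrc : ((y.unshift a).unshift b) ∈ {z : Site P j | ∀ κ, z κ ∈ I κ} := hy2
    have hp := hU ⟨(y.unshift a).unshift b, a, b, hab⟩ hsrc (by
      show (((y.unshift a).unshift b).shift a).shift b ∈ {z : Site P j | ∀ κ, z κ ∈ I κ}
      rw [unshift_unshift_comm y a b, shift_unshift, shift_unshift]; exact hy)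
    have heq : holAt U (walk y [(a, false), (b, false)]) * (holAt U (walk y [(b, false), (a, false)]))⁻¹ =
        (U ⟨(y.unshift a).unshift b, a⟩ * U ⟨((y.unshift a).unshift b).shift a, b⟩)⁻¹ *
          GaugeField.plaqHol U ⟨(y.unshift a).unshift b, a, b, hab⟩ * (U ⟨(y.unshift a).unshift b, a⟩ * U ⟨((y.unshift a).unshift b).shift a, b⟩)⁻¹⁻¹ := by
      rw [holAt_walk_ff, holAt_walk_ff]
      simp only [GaugeField.plaqHol]
      rw [unshift_unshift_comm y b a, shift_unshift _, show ((y.unshift a).unshift b).shift a = y.unshift b by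
        rw [unshift_unshift_comm, shift_unshift]]
      group
    rw [heq, GaugeGroup.dist1_conj]
    exact hp
  · -- (−a, +b): plaquette at z = y − a, upper-right corner y + b
    have hsrc : y.unshift a ∈ {z : Site P j | ∀ κ, z κ ∈ I κ} := hya
    have hp := hU ⟨y.unshift a, a, b, hab⟩ hsrc (by
      show ((y.unshift a).shift a).shift b ∈ {z : Site P j | ∀ κ, z κ ∈ I κ}
      rw [shift_unshift]; exact hyb)
    have heq : holAt U (walk y [(a, false), (b, true)]) * (holAt U (walk y [(b, true), (a, false)]))⁻¹ =
        (U ⟨y.unshift a, a⟩)⁻¹ * (GaugeField.plaqHol U ⟨y.unshift a, a, b, hab⟩)⁻¹ * (U ⟨y.unshift a, a⟩)⁻¹⁻¹ := by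
      rw [holAt_walk_ft, holAt_walk_tf]
      simp only [GaugeField.plaqHol]
      rw [shift_unshift, shift_unshift_comm y b a]
      group
    rw [heq, GaugeGroup.dist1_conj, GaugeGroup.dist1_inv]
    exact hp
  · -- (+a, −b): plaquette at z = y − b, upper-right corner y + a
    have hsrc : y.unshift b ∈ {z : Site P j | ∀ κ, z κ ∈ I κ} := by
      have : walkEnd y [(b, false)] = y.unshift b := rfl
      rw [← this]; exact hyb
    have hp := hU ⟨y.unshift b, a, b, hab⟩ hsrc (by
      show ((y.unshift b).shift a).shift b ∈ {z : Site P j | ∀ κ, z κ ∈ I κ}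
      rw [shift_shift_comm, shift_unshift]; exact hya)
    have heq : holAt U (walk y [(a, true), (b, false)]) * (holAt U (walk y [(b, false), (a, true)]))⁻¹ =
        (U ⟨y.unshift b, b⟩)⁻¹ * (GaugeField.plaqHol U ⟨y.unshift b, a, b, hab⟩)⁻¹ * (U ⟨y.unshift b, b⟩)⁻¹⁻¹ := by
      rw [holAt_walk_tf, holAt_walk_ft]
      simp only [GaugeField.plaqHol]
      rw [shift_unshift, shift_unshift_comm y a b]
      group
    rw [heq, GaugeGroup.dist1_conj, GaugeGroup.dist1_inv]
    exact hp
  · -- (+a, +b): the plaquette at y itself, upper-right corner y + a + b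
    have hp := hU ⟨y, a, b, hab⟩ hy hy2
    have heq : holAt U (walk y [(a, true), (b, true)]) * (holAt U (walk y [(b, true), (a, true)]))⁻¹ =
        1 * GaugeField.plaqHol U ⟨y, a, b, hab⟩ * 1⁻¹ := by
      rw [holAt_walk_tt, holAt_walk_tt]
      simp only [GaugeField.plaqHol]
      group
    rw [heq, GaugeGroup.dist1_conj]
    exact hp

/-- **THE COMMUTATOR DEFECT OF ANY TWO LETTERS IS WITHIN `δ` OF `1`, BOX-LOCAL**: base `y` and `y + m₁ + m₂` in the product set, the
plaquettes with both extreme corners in the product set within `δ ≥ 0` of `1`. [cite: Balaban1985Averaging, (9) p.19 and (19)-(20) p.21] -/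
theorem dist1_swapDefect_le_pi {δ : ℝ} (hδ : 0 ≤ δ)
    (hU : ∀ q : Plaq P j, q.src ∈ {z : Site P j | ∀ κ, z κ ∈ I κ} → (q.src.shift q.μ).shift q.ν ∈ {z : Site P j | ∀ κ, z κ ∈ I κ} → dist1 (GaugeField.plaqHol U q) ≤ δ)
    (y : Site P j) (m₁ m₂ : Letter P.d) (hy : y ∈ {z : Site P j | ∀ κ, z κ ∈ I κ}) (hy2 : walkEnd y [m₁, m₂] ∈ {z : Site P j | ∀ κ, z κ ∈ I κ}) :
    dist1 (holAt U (walk y [m₁, m₂]) * (holAt U (walk y [m₂, m₁]))⁻¹) ≤ δ := by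
  obtain ⟨a, s⟩ := m₁
  obtain ⟨b, t⟩ := m₂
  rcases lt_trichotomy a b with hab | rfl | hba
  · exact dist1_swapDefect_le_pi_of_lt U hU y hab s t hy hy2
  · rw [swapDefect_eq_one_of_parallel, GaugeGroup.dist1_one]; exact hδ
  · have hsymm : holAt U (walk y [(a, s), (b, t)]) * (holAt U (walk y [(b, t), (a, s)]))⁻¹ =
        (holAt U (walk y [(b, t), (a, s)]) * (holAt U (walk y [(a, s), (b, t)]))⁻¹)⁻¹ := by group
    rw [hsymm, GaugeGroup.dist1_inv]
    exact dist1_swapDefect_le_pi_of_lt U hU y hba t s hy (by rw [walkEnd_pair_comm]; exact hy2)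

/-- **AN ADJACENT TRANSPOSITION COSTS AT MOST `δ`, BOX-LOCAL**: `|𝒰_x(A m₁ m₂ C) − 1| ≤ δ + |𝒰_x(A m₂ m₁ C) − 1|` when the positions after
`A` and after `A m₁ m₂` lie in the product set. [cite: Balaban1985Averaging, (19)-(20) p.21] -/
theorem dist1_holAt_swap_le_pi {δ : ℝ} (hδ : 0 ≤ δ)
    (hU : ∀ q : Plaq P j, q.src ∈ {z : Site P j | ∀ κ, z κ ∈ I κ} → (q.src.shift q.μ).shift q.ν ∈ {z : Site P j | ∀ κ, z κ ∈ I κ} → dist1 (GaugeField.plaqHol U q) ≤ δ)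
    (x : Site P j) (A C : List (Letter P.d)) (m₁ m₂ : Letter P.d) (hA : walkEnd x A ∈ {z : Site P j | ∀ κ, z κ ∈ I κ})
    (hA2 : walkEnd (walkEnd x A) [m₁, m₂] ∈ {z : Site P j | ∀ κ, z κ ∈ I κ}) :
    dist1 (holAt U (walk x (A ++ m₁ :: m₂ :: C))) ≤ δ + dist1 (holAt U (walk x (A ++ m₂ :: m₁ :: C))) := by
  rw [holAt_walk_swap_eq U x A C m₁ m₂]
  refine (GaugeGroup.dist1_mul_le _ _).trans ?_
  rw [GaugeGroup.dist1_conj]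
  exact add_le_add (dist1_swapDefect_le_pi U hδ hU _ m₁ m₂ hA hA2) le_rfl

end Defect

end Summit.QuantumFields.YangMills.Theorems.BoxStokes
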